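import Literature.Algebra.Homology.DiscreteRepInflation
import Literature.Algebra.Homology.DiscreteRepInvariants
import Literature.Algebra.Homology.DiscreteRepRestrictionExact
import Literature.Algebra.Homology.RepExtGroupCohomology
import Mathlib.Algebra.Homology.DerivedCategory.Ext.Map
import HarnessLib

/-!
# Inflation from a finite layer on `Ext`: `Extⁿ_{Rep k (Γ⧸U)}(k, M^U) → Extⁿ_{C_Γ}(k, M)` for `U` open
# normal — exactness of the inflation functor, naturality, and compatibility with connecting maps

Topic `Algebra/Homology`; namespace `Literature.Algebra.Homology.DiscreteRep`.  Definitions with bodies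
and theorems; no named fact, no `sorry`; instances only for (co)limit preservation / additivity of the
inflation functor.  Sequel of `DiscreteRepInflation` (door-c4 g12: `infFunctor k U hU : Rep k (Γ ⧸ U) ⥤
C_Γ` ⊣ `invariantsQuotFunctor k U : C_Γ ⥤ Rep k (Γ ⧸ U)`, `M ↦ M^U`; `I^U` injective for `I`
injective in `C_Γ` — Harari Remark 4.24), `DiscreteRepRestrictionExact` (exactness of the inclusion
`ι`) and `RepExtGroupCohomology` (instance `HasExt (Rep k G)`).  Written for Route A of the Poitou–Tate programme of crux `stmt-BirchSwinnertonDyer-19295` (cell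
`bsd-schneider-ideate`, seat door-c4 gen 14), item (d) of FINDING-door-c4-g13/g14:
**`Hʳ(Γ, M) = lim→_U Hʳ(Γ/U, M^U)`** (Serre, *Galois Cohomology* I §2.2 Prop. 8; Harari Prop. 4.18 /
Remark 4.24), to be proved on `Ext` by dimension shifting along injective presentations; this file
provides the maps of that direct system and their formal properties:

* §1 `infFunctor` is EXACT (`preservesFiniteLimits_infFunctor`, `preservesFiniteColimits_infFunctor`:
  `infFunctor ⋙ ι = Rep.resFunctor (Γ → Γ⧸U)` preserves all (co)limits and `ι` reflects them) and
  additive; `infFunctor_trivial` (the inflation of the trivial representation IS `triv k`, `rfl`).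
* §2 `invariantsIncl U hU M : Inf(M^U) ⟶ M` (the inclusion, = counit), its naturality, and
  **`extInf U hU M n : Ext (Rep.trivial k (Γ ⧸ U) k) (M^U) n →+ Ext (triv k) M n`**,
  `y ↦ Inf(y) ≫ incl` (`Ext.mapExactFunctor` along the exact `infFunctor`); `extInf_mk₀` (degree 0);
  `extInf_naturality` (in `M`).
* §3 **`mapExactFunctor_infFunctor_comp_extClass`**: compatibility with connecting homomorphisms —
  for a short exact `S` in `Rep k (Γ ⧸ U)`, a short exact `T` in `C_Γ` and a morphism
  `φ : S.map Inf ⟶ T`, `(Inf y ≫ φ.τ₃) ≫ δ_T = Inf(y ≫ δ_S) ≫ φ.τ₁` (Mathlib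
  `Ext.mapExactFunctor_extClass` + `extClass_naturality`); stated for a general exact functor between
  abelian categories as `ExtFunctoriality.mapExactFunctor_comp_extClass_of_hom` (§0);
  `extInf_eq_zero_of_injective`.

Not here (sequels): the transition maps between two layers `V ≤ U` and `extInf_V ∘ t_{UV} = extInf_U`;
the finitariness of `Ext_{Rep k G}(k, –)` for finite `G`; the colimit theorem itself.
HONEST FRAMING: homological algebra only.

## References
* D. Harari, *Galois Cohomology and Class Field Theory*, Universitext, Springer (2020), §4.3
  Proposition 4.18 and Remark 4.24 (p. 95). [Harari2020]
* J.-P. Serre, *Galois Cohomology*, Springer (1997), I §2.2 Proposition 8. [SerreGaloisCohomology1997]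
-/

noncomputable section

universe w w' v v' u u'

namespace Literature.Algebra.Homology

/-! ## §0 A general compatibility: exact functors, morphisms of short exact sequences, `extClass` -/

namespace ExtFunctoriality

open CategoryTheory CategoryTheory.Limits CategoryTheory.Abelian

variable {A : Type u} [Category.{v} A] [Abelian A] [HasExt.{w} A]
  {B : Type u'} [Category.{v'} B] [Abelian B] [HasExt.{w'} B]
  (F : A ⥤ B) [F.Additive] [PreservesFiniteLimits F] [PreservesFiniteColimits F]

/-- **Exact functors, morphisms of short exact sequences and connecting classes.**  For `S` short
exact in `A`, `T` short exact in `B`, a morphism `φ : S.map F ⟶ T` and `y ∈ Extⁿ(X, S.X₃)`: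
`(F y ≫ φ.τ₃) ≫ [T] = F(y ≫ [S]) ≫ φ.τ₁` in `Extⁿ⁺¹(F X, T.X₁)`.
[cite: Harari2020, §4.3 Remark 4.24] -/
theorem mapExactFunctor_comp_extClass_of_hom {S : ShortComplex A} (hS : S.ShortExact)
    {T : ShortComplex B} (hT : T.ShortExact) (φ : S.map F ⟶ T) {X : A} {n : ℕ} (y : Ext X S.X₃ n) :
    ((y.mapExactFunctor F).comp (Ext.mk₀ φ.τ₃) (add_zero n)).comp hT.extClass (rfl : n + 1 = n + 1) =
      ((y.comp hS.extClass (rfl : n + 1 = n + 1)).mapExactFunctor F).comp (Ext.mk₀ φ.τ₁)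
        (add_zero (n + 1)) := by
  rw [Ext.mapExactFunctor_comp, Ext.mapExactFunctor_extClass, Ext.comp_assoc_of_third_deg_zero,
    Ext.comp_assoc_of_second_deg_zero]
  exact congrArg (fun z => (y.mapExactFunctor F).comp z (rfl : n + 1 = n + 1))
    (ShortComplex.ShortExact.extClass_naturality (hS.map_of_exact F) hT φ).symm

end ExtFunctoriality

namespace DiscreteRep

open CategoryTheory CategoryTheory.Limits CategoryTheory.Abelian

variable {k Γ : Type u} [CommRing k] [Group Γ] [TopologicalSpace Γ] [IsTopologicalGroup Γ]
  (U : Subgroup Γ) [U.Normal] (hU : IsOpen (U : Set Γ))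

/-! ## §1 The inflation functor is exact -/

/-- `Inf : Rep k (Γ⧸U) ⥤ C_Γ` is additive. [cite: Harari2020, §4.3 Remark 4.24] -/
instance additive_infFunctor : (infFunctor k U hU).Additive where
  map_add := rfl

/-- **`Inf` preserves finite limits** (`Inf ⋙ ι = Rep.resFunctor (Γ → Γ⧸U)` preserves all limits and
`ι` reflects them). [cite: Harari2020, §4.3 Remark 4.24] -/
instance preservesFiniteLimits_infFunctor : PreservesFiniteLimits (infFunctor k U hU) := by
  haveI : PreservesFiniteLimits (infFunctor k U hU ⋙ ι k Γ) :=
    inferInstanceAs (PreservesFiniteLimits (Rep.resFunctor (QuotientGroup.mk' U)))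
  exact ⟨fun J _ _ => preservesLimitsOfShape_of_reflects_of_preserves (infFunctor k U hU) (ι k Γ)⟩

/-- **`Inf` preserves finite colimits.** [cite: Harari2020, §4.3 Remark 4.24] -/
instance preservesFiniteColimits_infFunctor : PreservesFiniteColimits (infFunctor k U hU) := by
  haveI : PreservesFiniteColimits (infFunctor k U hU ⋙ ι k Γ) :=
    inferInstanceAs (PreservesFiniteColimits (Rep.resFunctor (QuotientGroup.mk' U)))
  exact ⟨fun J _ _ => preservesColimitsOfShape_of_reflects_of_preserves (infFunctor k U hU) (ι k Γ)⟩

/-- **The inflation of the trivial representation of `Γ⧸U` is the trivial representation of `Γ`**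
(definitionally). [cite: Harari2020, §4.3 Remark 4.24] -/
theorem infFunctor_trivial (V : Type u) [AddCommGroup V] [Module k V] :
    (infFunctor k U hU).obj (Rep.trivial k (Γ ⧸ U) V) = triv (Γ := Γ) V := rfl

/-- On objects, underlying representation. [cite: Harari2020, §4.3 Remark 4.24] -/
theorem infFunctor_obj_obj (B : Rep.{u} k (Γ ⧸ U)) :
    ((infFunctor k U hU).obj B).obj = Rep.res (QuotientGroup.mk' U) B := rfl

/-- On morphisms, underlying maps are unchanged. [cite: Harari2020, §4.3 Remark 4.24] -/
@[simp]
theorem infFunctor_map_hom_apply {B B' : Rep.{u} k (Γ ⧸ U)} (f : B ⟶ B') (b : B.V) :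
    ((infFunctor k U hU).map f).hom.hom b = f.hom b := rfl

/-! ## §2 The inclusion `Inf(M^U) ⟶ M` and inflation on `Ext` -/

/-- **The inclusion `Inf(M^U) ⟶ M`** in `C_Γ` (the counit of `Inf ⊣ (·)^U`).
[cite: Harari2020, §4.3 Remark 4.24] -/
def invariantsIncl (M : DiscreteRepCat k Γ) :
    (infFunctor k U hU).obj ((invariantsQuotFunctor k U).obj M) ⟶ M :=
  ObjectProperty.homMk (homInfOfInvariants U _ M.obj (𝟙 _))

/-- Formula: `invariantsIncl` is `x ↦ x.1`. [cite: Harari2020, §4.3 Remark 4.24] -/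
@[simp]
theorem invariantsIncl_hom_apply (M : DiscreteRepCat k Γ) (x : (M.obj.quotientToInvariants U).V) :
    (invariantsIncl U hU M).hom.hom x = x.1 := rfl

/-- `invariantsIncl` is a monomorphism. [cite: Harari2020, §4.3 Remark 4.24] -/
instance mono_invariantsIncl (M : DiscreteRepCat k Γ) : Mono (invariantsIncl U hU M) := by
  apply (ι k Γ).mono_of_mono_map
  rw [Rep.mono_iff_injective]
  intro x y h
  exact Subtype.ext h

/-- **Naturality of the inclusion**: `Inf((·)^U g) ≫ incl = incl ≫ g`. [cite: Harari2020, §4.3 Remark 4.24] -/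
theorem infFunctor_map_invariantsIncl {M M' : DiscreteRepCat k Γ} (g : M ⟶ M') :
    (infFunctor k U hU).map ((invariantsQuotFunctor k U).map g) ≫ invariantsIncl U hU M' =
      invariantsIncl U hU M ≫ g :=
  ObjectProperty.hom_ext _ (Rep.hom_ext (DFunLike.ext _ _ fun _ => rfl))

/-- **Inflation on `Ext`: `Extⁿ_{Rep k (Γ⧸U)}(k, M^U) →+ Extⁿ_{C_Γ}(k, M)`, `y ↦ Inf(y) ≫ incl`**
(`Ext.mapExactFunctor` along the exact inflation functor, then post-composition with the inclusion
`M^U ⊆ M`). [cite: Harari2020, §4.3 Remark 4.24][cite: SerreGaloisCohomology1997, I §2.2 Proposition 8] -/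
def extInf (M : DiscreteRepCat k Γ) (n : ℕ) :
    Ext (Rep.trivial k (Γ ⧸ U) k) ((invariantsQuotFunctor k U).obj M) n →+ Ext (triv (Γ := Γ) k) M n :=
  ((Ext.mk₀ (invariantsIncl U hU M)).postcomp _ (add_zero n)).comp
    ((infFunctor k U hU).mapExtAddHom _ _ n)

/-- Formula for `extInf`. [cite: Harari2020, §4.3 Remark 4.24] -/
theorem extInf_apply (M : DiscreteRepCat k Γ) (n : ℕ)
    (y : Ext (Rep.trivial k (Γ ⧸ U) k) ((invariantsQuotFunctor k U).obj M) n) :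
    extInf U hU M n y =
      (y.mapExactFunctor (infFunctor k U hU)).comp (Ext.mk₀ (invariantsIncl U hU M)) (add_zero n) :=
  rfl

/-- **Degree `0`**: `extInf (mk₀ φ) = mk₀ (Inf φ ≫ incl)`. [cite: Harari2020, §4.3 Remark 4.24] -/
theorem extInf_mk₀ (M : DiscreteRepCat k Γ)
    (φ : Rep.trivial k (Γ ⧸ U) k ⟶ (invariantsQuotFunctor k U).obj M) :
    extInf U hU M 0 (Ext.mk₀ φ) = Ext.mk₀ ((infFunctor k U hU).map φ ≫ invariantsIncl U hU M) := by
  rw [extInf_apply, Ext.mapExactFunctor_mk₀, Ext.mk₀_comp_mk₀]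

/-- **Naturality of `extInf` in `M`**: `extInf (y ≫ g^U) = extInf y ≫ g`.
[cite: Harari2020, §4.3 Remark 4.24] -/
theorem extInf_naturality {M M' : DiscreteRepCat k Γ} (g : M ⟶ M') (n : ℕ)
    (y : Ext (Rep.trivial k (Γ ⧸ U) k) ((invariantsQuotFunctor k U).obj M) n) :
    extInf U hU M' n (y.comp (Ext.mk₀ ((invariantsQuotFunctor k U).map g)) (add_zero n)) =
      (extInf U hU M n y).comp (Ext.mk₀ g) (add_zero n) := by
  rw [extInf_apply, extInf_apply, Ext.mapExactFunctor_comp, Ext.mapExactFunctor_mk₀,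
    Ext.comp_assoc_of_third_deg_zero, Ext.mk₀_comp_mk₀, infFunctor_map_invariantsIncl,
    ← Ext.mk₀_comp_mk₀]
  exact (Ext.comp_assoc_of_second_deg_zero _ _ _ _).symm

/-- `extInf` vanishes on classes killed by `Inf` — in particular on all of `Ext^{q+1}(k, I^U)` when
`I^U` is injective. [cite: Harari2020, §4.3 Remark 4.24] -/
theorem extInf_eq_zero_of_injective (I : DiscreteRepCat k Γ)
    [Injective ((invariantsQuotFunctor k U).obj I)] (q : ℕ)
    (y : Ext (Rep.trivial k (Γ ⧸ U) k) ((invariantsQuotFunctor k U).obj I) (q + 1)) :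
    extInf U hU I (q + 1) y = 0 := by
  rw [Ext.eq_zero_of_injective y, map_zero]

/-! ## §3 Compatibility with connecting homomorphisms -/

/-- **`extInf` and connecting maps**: for `S` short exact in `Rep k (Γ⧸U)`, `T` short exact in `C_Γ`
and a morphism `φ : S.map Inf ⟶ T` (e.g. `S = (0 → M^U → I^U → Q'_U → 0)`, `T = (0 → M → I → Q → 0)`,
`φ` the inclusions): `(Inf y ≫ φ.τ₃) ≫ δ_T = Inf(y ≫ δ_S) ≫ φ.τ₁`.
[cite: Harari2020, §4.3 Remark 4.24][cite: SerreGaloisCohomology1997, I §2.2 Proposition 8] -/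
theorem mapExactFunctor_infFunctor_comp_extClass {S : ShortComplex (Rep.{u} k (Γ ⧸ U))}
    (hS : S.ShortExact) {T : ShortComplex (DiscreteRepCat k Γ)} (hT : T.ShortExact)
    (φ : S.map (infFunctor k U hU) ⟶ T) {X : Rep.{u} k (Γ ⧸ U)} {n : ℕ} (y : Ext X S.X₃ n) :
    ((y.mapExactFunctor (infFunctor k U hU)).comp (Ext.mk₀ φ.τ₃) (add_zero n)).comp hT.extClass
        (rfl : n + 1 = n + 1) =
      ((y.comp hS.extClass (rfl : n + 1 = n + 1)).mapExactFunctor (infFunctor k U hU)).comp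
        (Ext.mk₀ φ.τ₁) (add_zero (n + 1)) :=
  ExtFunctoriality.mapExactFunctor_comp_extClass_of_hom (infFunctor k U hU) hS hT φ y

end DiscreteRep

end Literature.Algebra.Homology
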